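import Summits.FinalStateConjecture.FinalStateConjecture.Theorems.EIHFluxBalanceModulatedKerrHandoffTameTransport
import Summits.FinalStateConjecture.FinalStateConjecture.Theorems.EIHFluxBalanceModulatedKerrHandoffStubBreatheTame
import Summits.FinalStateConjecture.FinalStateConjecture.Theorems.EIHFluxBalanceModulatedKerrHandoffStubBreatheImmersed
import Literature.Geometry.Lorentzian.TameGenericityLocalWindow
import Literature.Geometry.Lorentzian.TameBreathingCurve
import Literature.Geometry.Lorentzian.IsometryProofs
import HarnessLib

/-!
# `EIHFluxBalance.ModulatedKerrHandoff` (item stmt-FinalStateConjecture-17402, H′ — the TAME re-type) is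
# EQUIVALENT to the existence of TAME ESCAPE CURVES: immersion, injectivity, globalisation and
# two-sidedness of the witness are free

Line `Sketch` (tame template breathe ∘ trim ∘ kick; cards `Ideas/tame-template-breathe-trim-kick.md`,
`Ideas/trim-on-the-cure.md`; skeleton `Cruxes/ModulatedKerrHandoff/Lines/Sketch.lean`), lead prover
`prover-line-stmt-FinalStateConjecture-17402-0`, 2026-08-17.

The crux reads `∀ X, IsTameChristodoulouGeneric (admissibleVacuumData X) (HandoffPropT X) 1`
(`HandoffPropT`, `…TameDefs.lean`): through every exceptional admissible datum `d` an injective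
one-parameter family of admissible data, TAME on one end (jointly smooth, Dafermos–Rodnianski decay with
continuous mass, `wDist`-continuous at `0`), IMMERSED at `0`, all of whose members off `0` have the handoff
property. This file proves that four of these demands are bookkeeping:

* `exists_tameWindowWitness_of_tameCurve` — a TAME curve `F` of admissible data through `d` whose members
  with `0 < ‖c‖ < ε` are good is upgraded, by breathing it member-wise in a coordinate ball far out on its
  end (`c ↦ (breathe (σ (λ c₀)))^* (F c)`), to a tame (on the collared end: `stub_breatheTame`), immersed
  (`stub_breatheImmersed`), window-injective (an immersed smooth curve is injective near `0`), admissible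
  curve through `d` whose members with small `c ≠ 0` are good (transport, `…TameTransport.lean`);
* `modulatedKerrHandoff_of_tameEscape` — hence the crux follows from TAME ESCAPE: "through every
  exceptional admissible datum passes a tame curve of admissible data whose members with `0 < ‖c‖ < ε`
  have the handoff property" (window control suffices: `isTameChristodoulouGeneric_of_localWindow`); the
  conclusion is the crux's body VERBATIM (Theses-free, so a future closer may import this file);
* `tameEscape_of_modulatedKerrHandoff` — and conversely (forget immersion and injectivity; `ε = 1`);
* `exists_tameCurve_of_oneSided`, `modulatedKerrHandoff_of_tameEscapeOneSided` — ONE-SIDED window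
  control (`0 < c₀ < ε`) already suffices (squaring reparametrisation `c ↦ F ((c₀)² e₀)`, then breathe).

So the crux is EQUIVALENT to (one-sided) tame escape, its dynamical residue: the large-data final-state
content (censorship, capture into receding sub-extremal Kerr basins, convergence of masses and spins,
lab-chart synthesis with the weights and the clauses (T), (O), (R), (QS)) for the escaping members — the
open core conceded by every card of the crux, into which breathe ∘ trim ∘ kick or the trim door plug.
Nothing here is claimed about that core. The window-injectivity of an immersed smooth curve is the landed
`stub_injOn_of_immersed` (`…StubInjOnOfImmersed.lean`, p135009); a private copy is kept here because that
module was not importable on the check farm at the time of writing.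

References: D. Christodoulou, CQG 16 (1999) A23, p. A24 (genericity in a fixed space of data);
J. M. Lee, *Introduction to Smooth Manifolds* (2013), Prop. 2.25 / Thm. 4.25.
-/

set_option linter.dupNamespace false

noncomputable section

namespace Summit.FinalStateConjecture.FinalStateConjecture.Theorems.EIHFluxBalance.TameTemplate

open scoped Topology Manifold ContDiff
open Bundle Filter Set Function TopologicalSpace Literature.Geometry.Lorentzian InitialDataSet

/-! ## Window injectivity of an immersed smooth curve (private copy of `stub_injOn_of_immersed`) -/

section InjOn

/-- Along a direction with non-zero derivative a `C¹` function is injective near `0` (strict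
monotonicity of `t ↦ f (t u)` where its continuous derivative keeps its sign) — private copy of
`RobustClausewiseGenericity.exists_injOn_line_of_fderiv_ne` (`Theorems/RobustClausewiseGenericityAssembly`),
kept local to spare this file that module's import closure. [folklore] -/
private theorem exists_injOn_line_of_fderiv_ne' {E : Type*} [NormedAddCommGroup E] [NormedSpace ℝ E]
    {f : E → ℝ} (hf : ContDiff ℝ 1 f) {u : E}
    (hu : fderiv ℝ f 0 u ≠ 0) :
    ∃ δ : ℝ, 0 < δ ∧ ∀ t t' : ℝ, |t| < δ → |t'| < δ → f (t • u) = f (t' • u) → t = t' := by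
  set g : ℝ → ℝ := fun t => f (t • u) with hg_def
  have hline : ContDiff ℝ 1 (fun t : ℝ => t • u) := contDiff_id.smul contDiff_const
  have hg : ContDiff ℝ 1 g := hf.comp hline
  have hderiv : ∀ t : ℝ, HasDerivAt g (fderiv ℝ f (t • u) u) t := by
    intro t
    have h1 : HasDerivAt (fun s : ℝ => s • u) ((1 : ℝ) • u) t := (hasDerivAt_id t).smul_const u
    rw [one_smul] at h1
    exact ((hf.differentiable one_ne_zero) (t • u)).hasFDerivAt.comp_hasDerivAt t h1
  have hcont : Continuous (deriv g) := hg.continuous_deriv le_rfl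
  have hd0 : deriv g 0 = fderiv ℝ f 0 u := by
    rw [(hderiv 0).deriv, zero_smul]
  have hne : deriv g 0 ≠ 0 := by rwa [hd0]
  rcases lt_or_gt_of_ne hne with hneg | hpos
  · obtain ⟨δ, hδ, hball⟩ := Metric.eventually_nhds_iff.1
      (hcont.continuousAt.eventually (gt_mem_nhds hneg))
    refine ⟨δ, hδ, fun t t' ht ht' hEq => ?_⟩
    have hanti : StrictAntiOn g (Ioo (-δ) δ) := by
      refine strictAntiOn_of_deriv_neg (convex_Ioo _ _) hg.continuous.continuousOn ?_
      intro x hx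
      rw [interior_Ioo] at hx
      exact hball (by simpa [Real.dist_eq, abs_lt] using hx)
    exact hanti.injOn (by simpa [abs_lt] using ht) (by simpa [abs_lt] using ht') hEq
  · obtain ⟨δ, hδ, hball⟩ := Metric.eventually_nhds_iff.1
      (hcont.continuousAt.eventually (lt_mem_nhds hpos))
    refine ⟨δ, hδ, fun t t' ht ht' hEq => ?_⟩
    have hmono : StrictMonoOn g (Ioo (-δ) δ) := by
      refine strictMonoOn_of_deriv_pos (convex_Ioo _ _) hg.continuous.continuousOn ?_
      intro x hx
      rw [interior_Ioo] at hx
      exact hball (by simpa [Real.dist_eq, abs_lt] using hx)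
    exact hmono.injOn (by simpa [abs_lt] using ht) (by simpa [abs_lt] using ht') hEq

variable {X : Type} [TopologicalSpace X] [ChartedSpace E3 X] [IsManifold (𝓡 3) ∞ X]

/-- A scalar component `c ↦ s_c(v₀, w₀)` of a smooth family `c ↦ (x₀, s_c)` of bilinear forms on the
FIXED tangent space `T_{x₀} X` (a smooth map `ℝᵐ →` the bundle of bilinear forms on `TX` over the
constant base point `x₀`) is a smooth function of the parameter: read the section in the
trivialisation of `TX` at `x₀` (`contMDiffAt_bilin_iff`, `contMDiff_iff_contDiff`) and evaluate at the
(constant) trivialised vectors. Adapted from the block `hF` of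
`Theorems/RobustClausewiseGenericityGaugeEnrichment`. -/
private theorem contDiff_bilin_apply_of_contMDiff_family {m : ℕ} (x₀ : X)
    {s : EuclideanSpace ℝ (Fin m) → (TangentSpace (𝓡 3) x₀ →L[ℝ] TangentSpace (𝓡 3) x₀ →L[ℝ] ℝ)}
    (hs : ContMDiff 𝓘(ℝ, EuclideanSpace ℝ (Fin m)) ((𝓡 3).prod 𝓘(ℝ, E3 →L[ℝ] E3 →L[ℝ] ℝ)) ∞
      (fun c : EuclideanSpace ℝ (Fin m) ↦ TotalSpace.mk' (E3 →L[ℝ] E3 →L[ℝ] ℝ)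
        (E := fun x : X ↦ TangentSpace (𝓡 3) x →L[ℝ] TangentSpace (𝓡 3) x →L[ℝ] ℝ) x₀ (s c)))
    (v₀ w₀ : TangentSpace (𝓡 3) x₀) :
    ContDiff ℝ ∞ (fun c : EuclideanSpace ℝ (Fin m) ↦ s c v₀ w₀) := by
  set T := trivializationAt E3 (TangentSpace (𝓡 3) : X → Type _) x₀ with hT
  have h2 : ContMDiff 𝓘(ℝ, EuclideanSpace ℝ (Fin m)) 𝓘(ℝ, E3 →L[ℝ] E3 →L[ℝ] ℝ) ∞
      (fun c : EuclideanSpace ℝ (Fin m) ↦ (ContinuousLinearMap.precomp ℝ (T.symmL ℝ x₀)).comp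
        ((s c).comp (T.symmL ℝ x₀))) := fun c ↦
    ((contMDiffAt_bilin_iff (IX := 𝓘(ℝ, EuclideanSpace ℝ (Fin m))) (IB := 𝓡 3)
      (V := (TangentSpace (𝓡 3) : X → Type _)) (b := fun _ : EuclideanSpace ℝ (Fin m) ↦ x₀)
      (s := s) (x₀ := c)).1 (hs c)).2
  have h3 : ContDiff ℝ ∞ (fun c : EuclideanSpace ℝ (Fin m) ↦
      (ContinuousLinearMap.precomp ℝ (T.symmL ℝ x₀)).comp ((s c).comp (T.symmL ℝ x₀))) :=
    contMDiff_iff_contDiff.1 h2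
  have hx₀T : x₀ ∈ T.baseSet := FiberBundle.mem_baseSet_trivializationAt' x₀
  set u : E3 := T.continuousLinearMapAt ℝ x₀ v₀ with hu
  set u' : E3 := T.continuousLinearMapAt ℝ x₀ w₀ with hu'
  have hsu : T.symmL ℝ x₀ u = v₀ := T.symmL_continuousLinearMapAt hx₀T v₀
  have hsu' : T.symmL ℝ x₀ u' = w₀ := T.symmL_continuousLinearMapAt hx₀T w₀
  have h4 : (fun c : EuclideanSpace ℝ (Fin m) ↦ s c v₀ w₀) =
      fun c ↦ ((ContinuousLinearMap.precomp ℝ (T.symmL ℝ x₀)).comp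
        ((s c).comp (T.symmL ℝ x₀))) u u' := by
    funext c
    simp only [ContinuousLinearMap.coe_comp, Function.comp_apply,
      ContinuousLinearMap.precomp_apply, hsu, hsu']
  rw [h4]
  exact (h3.clm_apply contDiff_const).clm_apply contDiff_const

/-- The metric component `c ↦ h_{F c}(x₀)(v₀, w₀)` of a jointly smooth family of data, at a fixed point
and fixed tangent vectors, is a smooth function of the parameter (the first component of
`IsSmoothDataFamily` restricted to the slice `c ↦ (c, x₀)`). -/
private theorem contDiff_h_inner_apply_family {m : ℕ}
    {F : EuclideanSpace ℝ (Fin m) → InitialDataSet (𝓡 3) X} (hF : IsSmoothDataFamily m F)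
    (x₀ : X) (v₀ w₀ : TangentSpace (𝓡 3) x₀) :
    ContDiff ℝ ∞ (fun c : EuclideanSpace ℝ (Fin m) ↦ (F c).h.inner x₀ v₀ w₀) :=
  contDiff_bilin_apply_of_contMDiff_family x₀ (s := fun c ↦ (F c).h.inner x₀)
    (hF.1.comp (contMDiff_id.prodMk contMDiff_const)) v₀ w₀

/-- The extrinsic-curvature component `c ↦ k_{F c}(x₀)(v₀, w₀)` of a jointly smooth family of data, at
a fixed point and fixed tangent vectors, is a smooth function of the parameter (the second component
of `IsSmoothDataFamily` restricted to the slice `c ↦ (c, x₀)`). -/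
private theorem contDiff_k_apply_family {m : ℕ}
    {F : EuclideanSpace ℝ (Fin m) → InitialDataSet (𝓡 3) X} (hF : IsSmoothDataFamily m F)
    (x₀ : X) (v₀ w₀ : TangentSpace (𝓡 3) x₀) :
    ContDiff ℝ ∞ (fun c : EuclideanSpace ℝ (Fin m) ↦ (F c).k x₀ v₀ w₀) :=
  contDiff_bilin_apply_of_contMDiff_family x₀ (s := fun c ↦ (F c).k x₀)
    (hF.2.comp (contMDiff_id.prodMk contMDiff_const)) v₀ w₀

/-- **Window injectivity from one smooth scalar invariant.** If `g : ℝ¹ → ℝ` is smooth with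
`dg(0) e₀ ≠ 0` and `g` factors through `F` (`F c = F c' → g c = g c'`), then `F` is injective on a
window `‖c‖ < ε`: `t ↦ g (t e₀)` is strictly monotone for `|t| < δ`
(`exists_injOn_line_of_fderiv_ne'`), and on `ℝ¹` one has `c = c₀ e₀`,
`‖c‖ = |c₀|`. -/
private theorem exists_window_injOn_of_scalar {α : Type*} (F : EuclideanSpace ℝ (Fin 1) → α)
    {g : EuclideanSpace ℝ (Fin 1) → ℝ} (hg : ContDiff ℝ ∞ g)
    (hg0 : fderiv ℝ g 0 (EuclideanSpace.single (0 : Fin 1) (1 : ℝ)) ≠ 0)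
    (hFg : ∀ c c', F c = F c' → g c = g c') :
    ∃ ε > (0 : ℝ), ∀ c c', ‖c‖ < ε → ‖c'‖ < ε → F c = F c' → c = c' := by
  have hg1 : ContDiff ℝ 1 g := hg.of_le (by exact_mod_cast le_top)
  obtain ⟨δ, hδ, hinj⟩ := exists_injOn_line_of_fderiv_ne' hg1 hg0
  refine ⟨δ, hδ, fun c c' hc hc' hEq ↦ ?_⟩
  -- on `ℝ¹`: `c = c₀ e₀` and `‖c‖ = |c₀|`
  have hce : ∀ c : EuclideanSpace ℝ (Fin 1),
      c 0 • EuclideanSpace.single (0 : Fin 1) (1 : ℝ) = c := fun c ↦ by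
    ext i
    fin_cases i
    simp
  have hcn : ∀ c : EuclideanSpace ℝ (Fin 1), ‖c‖ = |c 0| := fun c ↦ by
    rw [EuclideanSpace.norm_eq, Fin.sum_univ_one, Real.norm_eq_abs, sq_abs, Real.sqrt_sq_eq_abs]
  have hgc : g (c 0 • EuclideanSpace.single (0 : Fin 1) (1 : ℝ)) =
      g (c' 0 • EuclideanSpace.single (0 : Fin 1) (1 : ℝ)) := by
    rw [hce c, hce c']
    exact hFg c c' hEq
  have h00 : c 0 = c' 0 :=
    hinj (c 0) (c' 0) (by rw [← hcn]; exact hc) (by rw [← hcn]; exact hc') hgc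
  rw [← hce c, ← hce c', h00]

/-- Local copy (private) of the landed `stub_injOn_of_immersed` (p135009), kept here because its
module is not yet importable on the check farm: a jointly smooth curve immersed at `0` is injective on
a window. [cite: Christodoulou1999, p. A24] -/
private theorem injOn_of_immersed_forall :
    ∀ (X : Type) [TopologicalSpace X] [ChartedSpace E3 X] [IsManifold (𝓡 3) ((⊤ : ℕ∞) : WithTop ℕ∞) X] [T2Space X] [SecondCountableTopology X] [ConnectedSpace X],
      ∀ (F : EuclideanSpace ℝ (Fin 1) → InitialDataSet (𝓡 3) X),
        IsSmoothDataFamily 1 F → IsImmersedAtZero 1 F →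
          ∃ ε > (0 : ℝ), ∀ c c', ‖c‖ < ε → ‖c'‖ < ε → F c = F c' → c = c' := by
  intro X _ _ _ _ _ _ F hF hI
  -- the basis vector of `ℝ¹` is non-zero; immersion there gives the witnessing component
  have he₀ : (EuclideanSpace.single (0 : Fin 1) (1 : ℝ) : EuclideanSpace ℝ (Fin 1)) ≠ 0 := by
    rw [← norm_ne_zero_iff, PiLp.norm_single, norm_one]
    exact one_ne_zero
  obtain ⟨x, u, w, huw⟩ := hI _ he₀
  rcases huw with h | h
  · exact exists_window_injOn_of_scalar F (contDiff_h_inner_apply_family hF x u w) h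
      (fun c c' hcc' ↦ by rw [hcc'])
  · exact exists_window_injOn_of_scalar F (contDiff_k_apply_family hF x u w) h
      (fun c c' hcc' ↦ by rw [hcc'])

end InjOn

/-- Window injectivity of an immersed jointly smooth curve, binder form of the local copy. [cite: Christodoulou1999, p. A24] -/
private theorem injOn_of_immersed {Y : Type} [TopologicalSpace Y] [ChartedSpace E3 Y]
    [IsManifold (𝓡 3) ((⊤ : ℕ∞) : WithTop ℕ∞) Y] [T2Space Y] [SecondCountableTopology Y] [ConnectedSpace Y]
    (F : EuclideanSpace ℝ (Fin 1) → InitialDataSet (𝓡 3) Y)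
    (hF : IsSmoothDataFamily 1 F) (himm : IsImmersedAtZero 1 F) :
    ∃ ε > (0 : ℝ), ∀ c c', ‖c‖ < ε → ‖c'‖ < ε → F c = F c' → c = c' :=
  injOn_of_immersed_forall Y F hF himm

/-! ## Upgrading a tame curve with good small members to a window witness -/

/-- **BREATHING UPGRADE.** If `F` is a TAME curve on the end `e` of admissible data through `d` whose
members with `0 < ‖c‖ < ε` have the handoff property, then breathing it member-wise in the unit
coordinate ball at `z₀ = (e.R + 3) e₀`, at the rate of `stub_breatheImmersed`, gives a curve which is
tame on the collared end `e.restrict (e.R + 5)` (`stub_breatheTame`), immersed at `0`, passes through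
`d` (`breathe 0 = id`), is injective and admissible on a window, and whose members with small `c ≠ 0`
have the handoff property (`handoffPropT_breatheFamily`) — the hypothesis shape of
`InitialDataSet.isTameChristodoulouGeneric_of_localWindow`. [cite: Christodoulou1999, p. A24] -/
theorem exists_tameWindowWitness_of_tameCurve :
    ∀ (X : Type) [TopologicalSpace X] [ChartedSpace E3 X] [IsManifold (𝓡 3) ((⊤ : ℕ∞) : WithTop ℕ∞) X] [T2Space X] [SecondCountableTopology X] [ConnectedSpace X] (d : InitialDataSet (𝓡 3) X) (e : AFEnd X) (F : EuclideanSpace ℝ (Fin 1) → InitialDataSet (𝓡 3) X), IsTameDataFamily e 1 F → F 0 = d → (∀ c, F c ∈ admissibleVacuumData X) → ∀ ε : ℝ, 0 < ε → (∀ c, c ≠ 0 → ‖c‖ < ε → HandoffPropT X (F c)) → ∃ (e' : AFEnd X) (ε' : ℝ) (F' : EuclideanSpace ℝ (Fin 1) → InitialDataSet (𝓡 3) X), 0 < ε' ∧ IsTameDataFamily e' 1 F' ∧ IsImmersedAtZero 1 F' ∧ F' 0 = d ∧ (∀ c c', ‖c‖ < ε' → ‖c'‖ < ε' → F' c = F'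 c' → c = c') ∧ (∀ c, ‖c‖ < ε' → F' c ∈ admissibleVacuumData X) ∧ ∀ c, c ≠ 0 → ‖c‖ < ε' → HandoffPropT X (F' c) := by
  intro X _ _ _ _ _ _ d e F hF hF0 hF𝓓 ε hε hgood
  -- a breathing ball far out on `e`, and a collar beyond it
  set z₀ : E3 := (e.R + 3) • EuclideanSpace.single (0 : Fin 3) (1 : ℝ) with hz₀
  have hz₀n : ‖z₀‖ = e.R + 3 := by
    rw [hz₀, norm_smul, PiLp.norm_single, norm_one, mul_one,
      Real.norm_of_nonneg (by linarith [e.R_pos])]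
  have B : e.BreathingData z₀ 1 := ⟨one_pos, by rw [hz₀n]; linarith⟩
  have hzR : ‖z₀‖ + 1 ≤ e.R + 5 := by rw [hz₀n]; linarith
  have hR : e.R < e.R + 5 := by linarith
  -- the rate, the breathed curve, its tameness and its window of injectivity
  obtain ⟨lam, himm⟩ := stub_breatheImmersed X e z₀ B F hF.1
  have hF' : IsTameDataFamily (e.restrict hR.le) 1
      (fun c ↦ AFEnd.breatheFamily B (F c) (lam * c 0)) :=
    stub_breatheTame X e z₀ B (e.R + 5) hzR hR lam F hF
  obtain ⟨ε', hε', hinj⟩ :=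
    injOn_of_immersed (fun c ↦ AFEnd.breatheFamily B (F c) (lam * c 0)) hF'.1 himm
  refine ⟨e.restrict hR.le, min ε ε', fun c ↦ AFEnd.breatheFamily B (F c) (lam * c 0),
    lt_min hε hε', hF', himm, ?_, ?_, ?_, ?_⟩
  · -- through `d`
    show AFEnd.breatheFamily B (F 0) (lam * (0 : EuclideanSpace ℝ (Fin 1)) 0) = d
    rw [PiLp.zero_apply, mul_zero, AFEnd.breatheFamily_zero, hF0]
  · -- injective on the window
    intro c c' hc hc' h
    exact hinj c c' (lt_of_lt_of_le hc (min_le_right _ _)) (lt_of_lt_of_le hc' (min_le_right _ _)) h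
  · -- admissible members
    intro c _
    simpa using
      AFEnd.breatheCurve_mem_admissibleVacuumData B (F c) (hF𝓓 c)
        (EuclideanSpace.single (0 : Fin 1) (lam * c 0))
  · -- good members on the window
    intro c hc hcε
    exact (handoffPropT_breatheFamily B (F c) (lam * c 0)).2
      (hgood c hc (lt_of_lt_of_le hcε (min_le_left _ _)))

/-! ## The crux is equivalent to tame escape -/

-- operator-norm instance paths on form-valued maps are slow to unify (clause (QS))
set_option synthInstance.maxHeartbeats 400000 in
/-- **`ModulatedKerrHandoff` FROM TAME ESCAPE.** If through every admissible datum failing the handoff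
property passes a TAME curve of admissible data (no immersion, no injectivity asked) whose members with
`0 < ‖c‖ < ε` have the handoff property, then the crux holds — conclusion = the body of
`Theses.EIHFluxBalance.ModulatedKerrHandoff` VERBATIM (it `δ`-unfolds to the route decl; this file does not
import the route file). Proof: `exists_tameWindowWitness_of_tameCurve` +
`isTameChristodoulouGeneric_of_localWindow`. [cite: Christodoulou1999, p. A24] -/
theorem modulatedKerrHandoff_of_tameEscape
    (hesc : ∀ (X : Type) [TopologicalSpace X] [ChartedSpace E3 X] [IsManifold (𝓡 3) ((⊤ : ℕ∞) : WithTop ℕ∞) X] [T2Space X] [SecondCountableTopology X] [ConnectedSpace X], ∀ d ∈ admissibleVacuumData X, ¬ HandoffPropT X d → ∃ (e : AFEnd X) (F : EuclideanSpace ℝ (Fin 1) → InitialDataSet (𝓡 3) X), IsTameDataFamily e 1 F ∧ F 0 = d ∧ (∀ c, F c ∈ admissibleVacuumData X) ∧ ∃ ε > (0 : ℝ), ∀ c, c ≠ 0 → ‖c‖ < ε → HandoffPropT X (F c)) :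
    ∀ (X : Type) [TopologicalSpace X] [ChartedSpace E3 X] [IsManifold (𝓡 3) ((⊤ : ℕ∞) : WithTop ℕ∞) X] [T2Space X] [SecondCountableTopology X] [ConnectedSpace X], InitialDataSet.IsTameChristodoulouGeneric (admissibleVacuumData X) (fun D ↦ (∃ 𝒟 : VacuumCauchyDevelopment D, 𝒟.IsMaximal) ∧ ∀ 𝒟 : VacuumCauchyDevelopment D, 𝒟.IsMaximal → Summit.FinalStateConjecture.HasCompleteNullInfinity 𝒟.toCauchyDevelopment ∧ (∃ (N : ℕ) (M a rin : Fin N → ℝ) (Λ : Fin N → ℝ → lorentzGroup) (ξ : Fin N → ℝ → E3) (γ κ τ₀ : ℝ) (U : Opens E4) (Φ : U → 𝒟.carrier) (O : Set 𝒟.carrier), (∀ i, Kerr.IsSubextremal (M i) (a i) ∧ Kerr.rMinus (M i) (a i) < rin i ∧ rin i < Kerr.rPlus (M i) (a i)) ∧ (∀ i t, |((Λ i t : E4 ≃L[ℝ] E4) (E4.basisVector 0)) 0| ≤ γ) ∧ (∀ i, ContDiff ℝ ((⊤ : ℕ∞) : WithTop ℕ∞) (ξ i) ∧ ContDiff ℝ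 ((⊤ : ℕ∞) : WithTop ℕ∞) (fun t ↦ ((Λ i t : E4 ≃L[ℝ] E4) : E4 →L[ℝ] E4))) ∧ (∀ i j, i ≠ j → Tendsto (fun t ↦ ‖ξ i t - ξ j t‖) atTop atTop) ∧ (0 < κ ∧ κ < 1 ∧ ∀ i, ∀ᶠ t in atTop, ‖ξ i t‖ ≤ κ ^ 2 * t) ∧ ({x : E4 | τ₀ < x 0 ∧ ∀ i, rin i < Kerr.radius (a i) (poincareInv (Λ i (x 0)) (E4.ofTimeSpace (x 0) (ξ i (x 0))) x)} ⊆ (U : Set E4)) ∧ let B : ModelBackground := ⟨U, fun x ↦ Minkowski.bilin + ∑ i, (boostedKerrBilin (Λ i (x 0)) (E4.ofTimeSpace (x 0) (ξ i (x 0))) (M i) (a i) x - Minkowski.bilin), fun x ↦ x 0, E4.spatialNorm⟩; ContMDiff 𝓘(ℝ, E4) (𝓡 4) ((⊤ : ℕ∞) : WithTop ℕ∞) Φ ∧ Topology.IsOpenEmbedding ((B.lateRegion τ₀).restrict Φ) ∧ Φ '' {x : U | τ₀ < x.1 0 ∧ ∀ i, Kerr.rPlus (M i) (a i) < Kerr.radius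 (a i) (poincareInv (Λ i (x.1 0)) (E4.ofTimeSpace (x.1 0) (ξ i (x.1 0))) x.1)} ⊆ O ∧ Tendsto (fun t ↦ 𝒟.toSpacetime.deviationCk B Φ 3 t) atTop (𝓝 0) ∧ Tendsto (fun t : ℝ ↦ ⨆ x ∈ {x : U | x.1 0 = t ∧ E4.spatialNorm x.1 ≤ κ * t}, ⨆ (m : ℕ) (_ : m ≤ 3), ENNReal.ofReal (1 + √(√((⨅ i, ‖E4.spatial x.1 - ξ i t‖) ^ 7))) * ‖iteratedFDeriv ℝ m (𝒟.toSpacetime.deviationExtend B Φ) x.1‖ₑ) atTop (𝓝 0) ∧ O = Summit.FinalStateConjecture.exteriorOf 𝒟.toCauchyDevelopment (Φ '' {x : U | τ₀ < x.1 0 ∧ ∀ i, Kerr.rPlus (M i) (a i) < Kerr.radius (a i) (poincareInv (Λ i (x.1 0)) (E4.ofTimeSpace (x.1 0) (ξ i (x.1 0))) x.1)}) ∧ (∀ t₁ : ℝ, τ₀ < t₁ → O \ Φ '' {x : U | t₁ < x.1 0 ∧ ∀ i, Kerr.rPlus (M i) (a i) < Kerr.radius (a i) (poincareInv (Λ i (x.1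 0)) (E4.ofTimeSpace (x.1 0) (ξ i (x.1 0))) x.1)} ⊆ 𝒟.metric.causalPast 𝒟.timeOrientation (Φ '' {x : U | x.1 0 = t₁ ∧ ∀ i, Kerr.rPlus (M i) (a i) < Kerr.radius (a i) (poincareInv (Λ i (x.1 0)) (E4.ofTimeSpace (x.1 0) (ξ i (x.1 0))) x.1)})) ∧ (∃ τ₁ : ℝ, ∀ x y : U, (τ₁ < x.1 0 ∧ ∀ i, rin i < Kerr.radius (a i) (poincareInv (Λ i (x.1 0)) (E4.ofTimeSpace (x.1 0) (ξ i (x.1 0))) x.1)) → (τ₁ < y.1 0 ∧ ∀ i, rin i < Kerr.radius (a i) (poincareInv (Λ i (y.1 0)) (E4.ofTimeSpace (y.1 0) (ξ i (y.1 0))) y.1)) → Φ y ∈ 𝒟.metric.causalFuture 𝒟.timeOrientation {Φ x} → x.1 0 ≤ y.1 0) ∧ (∀ (i : Fin N) (t : ℝ), 0 < (((Λ i t : lorentzGroup) : E4 ≃L[ℝ] E4) (E4.basisVector 0)) 0) ∧ Summit.FinalStateConjecture.RaysStayInClosure 𝒟.toCauchyDevelopment O ∧ (∀ ρ : ℝ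 → ℝ, Tendsto ρ atTop atTop → Tendsto (fun t : ℝ ↦ ⨆ x ∈ {x : E4 | x 0 = t ∧ E4.spatialNorm x ≤ κ * t ∧ ρ t ≤ ⨅ i, ‖E4.spatial x - ξ i t‖}, ENNReal.ofReal (1 + √(√((⨅ i, ‖E4.spatial x - ξ i t‖) ^ 7))) * ‖fderiv ℝ (fun y : E4 ↦ Minkowski.bilin + ∑ i, (boostedKerrBilin (Λ i (y 0)) (E4.ofTimeSpace (y 0) (ξ i (y 0))) (M i) (a i) y - Minkowski.bilin)) x (E4.basisVector 0)‖ₑ) atTop (𝓝 0)))) 1 := by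
  intro X _ _ _ _ _ _
  show IsTameChristodoulouGeneric (admissibleVacuumData X) (HandoffPropT X) 1
  refine isTameChristodoulouGeneric_of_localWindow fun d hd hP ↦ ?_
  obtain ⟨e, F, hF, hF0, hF𝓓, ε, hε, hgood⟩ := hesc X d hd hP
  obtain ⟨e', ε', F', hε', hF', himm, hF'0, hinj, h𝓓, hP'⟩ :=
    exists_tameWindowWitness_of_tameCurve X d e F hF hF0 hF𝓓 ε hε hgood
  exact ⟨e', ε', F', hε', hF', himm, hF'0, hinj, h𝓓, hP'⟩

-- operator-norm instance paths on form-valued maps are slow to unify (clause (QS))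
set_option synthInstance.maxHeartbeats 400000 in
/-- **TAME ESCAPE FROM `ModulatedKerrHandoff`** (the converse: forget immersion and injectivity,
`ε = 1`) — so the crux is EQUIVALENT to tame escape. Hypothesis = the body of the route decl verbatim.
[cite: Christodoulou1999, p. A24] -/
theorem tameEscape_of_modulatedKerrHandoff
    (h : ∀ (X : Type) [TopologicalSpace X] [ChartedSpace E3 X] [IsManifold (𝓡 3) ((⊤ : ℕ∞) : WithTop ℕ∞) X] [T2Space X] [SecondCountableTopology X] [ConnectedSpace X], InitialDataSet.IsTameChristodoulouGeneric (admissibleVacuumData X) (fun D ↦ (∃ 𝒟 : VacuumCauchyDevelopment D, 𝒟.IsMaximal) ∧ ∀ 𝒟 : VacuumCauchyDevelopment D, 𝒟.IsMaximal → Summit.FinalStateConjecture.HasCompleteNullInfinity 𝒟.toCauchyDevelopment ∧ (∃ (N : ℕ) (M a rin : Fin N → ℝ) (Λ : Fin N → ℝ → lorentzGroup) (ξ : Fin N → ℝ → E3) (γ κ τ₀ : ℝ) (U : Opens E4) (Φ : U → 𝒟.carrier) (O : Set 𝒟.carrier), (∀ i, Kerr.IsSubextremal (M i) (a i) ∧ Kerr.rMinus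 (M i) (a i) < rin i ∧ rin i < Kerr.rPlus (M i) (a i)) ∧ (∀ i t, |((Λ i t : E4 ≃L[ℝ] E4) (E4.basisVector 0)) 0| ≤ γ) ∧ (∀ i, ContDiff ℝ ((⊤ : ℕ∞) : WithTop ℕ∞) (ξ i) ∧ ContDiff ℝ ((⊤ : ℕ∞) : WithTop ℕ∞) (fun t ↦ ((Λ i t : E4 ≃L[ℝ] E4) : E4 →L[ℝ] E4))) ∧ (∀ i j, i ≠ j → Tendsto (fun t ↦ ‖ξ i t - ξ j t‖) atTop atTop) ∧ (0 < κ ∧ κ < 1 ∧ ∀ i, ∀ᶠ t in atTop, ‖ξ i t‖ ≤ κ ^ 2 * t) ∧ ({x : E4 | τ₀ < x 0 ∧ ∀ i, rin i < Kerr.radius (a i) (poincareInv (Λ i (x 0)) (E4.ofTimeSpace (x 0) (ξ i (x 0))) x)} ⊆ (U : Set E4)) ∧ let B : ModelBackground := ⟨U, fun x ↦ Minkowski.bilin + ∑ i, (boostedKerrBilin (Λ i (x 0)) (E4.ofTimeSpace (x 0) (ξ i (x 0))) (M i) (a i) x - Minkowski.bilin), fun x ↦ x 0, E4.spatialNorm⟩;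 ContMDiff 𝓘(ℝ, E4) (𝓡 4) ((⊤ : ℕ∞) : WithTop ℕ∞) Φ ∧ Topology.IsOpenEmbedding ((B.lateRegion τ₀).restrict Φ) ∧ Φ '' {x : U | τ₀ < x.1 0 ∧ ∀ i, Kerr.rPlus (M i) (a i) < Kerr.radius (a i) (poincareInv (Λ i (x.1 0)) (E4.ofTimeSpace (x.1 0) (ξ i (x.1 0))) x.1)} ⊆ O ∧ Tendsto (fun t ↦ 𝒟.toSpacetime.deviationCk B Φ 3 t) atTop (𝓝 0) ∧ Tendsto (fun t : ℝ ↦ ⨆ x ∈ {x : U | x.1 0 = t ∧ E4.spatialNorm x.1 ≤ κ * t}, ⨆ (m : ℕ) (_ : m ≤ 3), ENNReal.ofReal (1 + √(√((⨅ i, ‖E4.spatial x.1 - ξ i t‖) ^ 7))) * ‖iteratedFDeriv ℝ m (𝒟.toSpacetime.deviationExtend B Φ) x.1‖ₑ) atTop (𝓝 0) ∧ O = Summit.FinalStateConjecture.exteriorOf 𝒟.toCauchyDevelopment (Φ '' {x : U | τ₀ < x.1 0 ∧ ∀ i, Kerr.rPlus (M i) (a i) < Kerr.radius (a i) (poincareInv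 (Λ i (x.1 0)) (E4.ofTimeSpace (x.1 0) (ξ i (x.1 0))) x.1)}) ∧ (∀ t₁ : ℝ, τ₀ < t₁ → O \ Φ '' {x : U | t₁ < x.1 0 ∧ ∀ i, Kerr.rPlus (M i) (a i) < Kerr.radius (a i) (poincareInv (Λ i (x.1 0)) (E4.ofTimeSpace (x.1 0) (ξ i (x.1 0))) x.1)} ⊆ 𝒟.metric.causalPast 𝒟.timeOrientation (Φ '' {x : U | x.1 0 = t₁ ∧ ∀ i, Kerr.rPlus (M i) (a i) < Kerr.radius (a i) (poincareInv (Λ i (x.1 0)) (E4.ofTimeSpace (x.1 0) (ξ i (x.1 0))) x.1)})) ∧ (∃ τ₁ : ℝ, ∀ x y : U, (τ₁ < x.1 0 ∧ ∀ i, rin i < Kerr.radius (a i) (poincareInv (Λ i (x.1 0)) (E4.ofTimeSpace (x.1 0) (ξ i (x.1 0))) x.1)) → (τ₁ < y.1 0 ∧ ∀ i, rin i < Kerr.radius (a i) (poincareInv (Λ i (y.1 0)) (E4.ofTimeSpace (y.1 0) (ξ i (y.1 0))) y.1)) → Φ y ∈ 𝒟.metric.causalFuture 𝒟.timeOrientation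 {Φ x} → x.1 0 ≤ y.1 0) ∧ (∀ (i : Fin N) (t : ℝ), 0 < (((Λ i t : lorentzGroup) : E4 ≃L[ℝ] E4) (E4.basisVector 0)) 0) ∧ Summit.FinalStateConjecture.RaysStayInClosure 𝒟.toCauchyDevelopment O ∧ (∀ ρ : ℝ → ℝ, Tendsto ρ atTop atTop → Tendsto (fun t : ℝ ↦ ⨆ x ∈ {x : E4 | x 0 = t ∧ E4.spatialNorm x ≤ κ * t ∧ ρ t ≤ ⨅ i, ‖E4.spatial x - ξ i t‖}, ENNReal.ofReal (1 + √(√((⨅ i, ‖E4.spatial x - ξ i t‖) ^ 7))) * ‖fderiv ℝ (fun y : E4 ↦ Minkowski.bilin + ∑ i, (boostedKerrBilin (Λ i (y 0)) (E4.ofTimeSpace (y 0) (ξ i (y 0))) (M i) (a i) y - Minkowski.bilin)) x (E4.basisVector 0)‖ₑ) atTop (𝓝 0)))) 1) :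
    ∀ (X : Type) [TopologicalSpace X] [ChartedSpace E3 X] [IsManifold (𝓡 3) ((⊤ : ℕ∞) : WithTop ℕ∞) X] [T2Space X] [SecondCountableTopology X] [ConnectedSpace X], ∀ d ∈ admissibleVacuumData X, ¬ HandoffPropT X d → ∃ (e : AFEnd X) (F : EuclideanSpace ℝ (Fin 1) → InitialDataSet (𝓡 3) X), IsTameDataFamily e 1 F ∧ F 0 = d ∧ (∀ c, F c ∈ admissibleVacuumData X) ∧ ∃ ε > (0 : ℝ), ∀ c, c ≠ 0 → ‖c‖ < ε → HandoffPropT X (F c) := by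
  intro X _ _ _ _ _ _ d hd hP
  obtain ⟨e, F, hF, -, h0, -, hD, hgood⟩ := h X d ⟨hd, hP⟩
  refine ⟨e, F, hF, h0, hD, 1, one_pos, fun c hc _ ↦ ?_⟩
  by_contra hPc
  exact hgood c hc ⟨hD c, hPc⟩

/-! ## One-sided control suffices -/

section OneSided

variable {X : Type} [TopologicalSpace X] [ChartedSpace E3 X] [IsManifold (𝓡 3) ((⊤ : ℕ∞) : WithTop ℕ∞) X]

/-- The squaring reparametrisation `c ↦ (c₀)² e₀` of `ℝ¹` is smooth. [folklore] -/
private theorem contDiff_sqParam :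
    ContDiff ℝ ∞ (fun c : EuclideanSpace ℝ (Fin 1) ↦
      ((c 0) ^ 2) • (EuclideanSpace.single (0 : Fin 1) (1 : ℝ) : EuclideanSpace ℝ (Fin 1))) := by
  have h0 : ContDiff ℝ ∞ (fun c : EuclideanSpace ℝ (Fin 1) ↦ c 0) :=
    contDiff_piLp_apply (𝕜 := ℝ) (n := ∞) (p := 2) (E := fun _ : Fin 1 => ℝ) (i := 0)
  exact (h0.pow 2).smul contDiff_const

/-- **ONE-SIDED WINDOW CONTROL SUFFICES FOR TAME CURVES.** A tame curve `F` on the end `e` of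
`𝓓`-data whose members with `0 < c₀ < ε` satisfy `P` yields, by the squaring reparametrisation
`c ↦ F ((c₀)² e₀)` (smooth, fixing `0`: tameness composes, `IsTameDataFamily.comp_contDiff`), a tame
curve on the same end through the same base datum, with members in `𝓓`, all of whose members with
`0 < ‖c‖ < min ε 1` satisfy `P`. (Immersion is lost — the composite is flat at `0` — and is restored
afterwards by breathing, `exists_tameWindowWitness_of_tameCurve`.) [cite: Christodoulou1999, p. A24] -/
theorem exists_tameCurve_of_oneSided {e : AFEnd X} {𝓓 : Set (InitialDataSet (𝓡 3) X)}
    {P : InitialDataSet (𝓡 3) X → Prop} {F : EuclideanSpace ℝ (Fin 1) → InitialDataSet (𝓡 3) X}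
    (hF : IsTameDataFamily e 1 F) (h𝓓 : ∀ c, F c ∈ 𝓓) {ε : ℝ} (hε : 0 < ε)
    (hP : ∀ c, 0 < c 0 → c 0 < ε → P (F c)) :
    ∃ F' : EuclideanSpace ℝ (Fin 1) → InitialDataSet (𝓡 3) X,
      IsTameDataFamily e 1 F' ∧ F' 0 = F 0 ∧ (∀ c, F' c ∈ 𝓓) ∧
        ∃ ε' > (0 : ℝ), ∀ c, c ≠ 0 → ‖c‖ < ε' → P (F' c) := by
  set φ : EuclideanSpace ℝ (Fin 1) → EuclideanSpace ℝ (Fin 1) :=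
    fun c ↦ ((c 0) ^ 2) • (EuclideanSpace.single (0 : Fin 1) (1 : ℝ) : EuclideanSpace ℝ (Fin 1))
    with hφ
  have hφ0 : φ 0 = 0 := by
    rw [hφ]
    simp
  have hφc : ∀ c : EuclideanSpace ℝ (Fin 1), φ c 0 = (c 0) ^ 2 := fun c ↦ by
    simp [hφ]
  refine ⟨fun c ↦ F (φ c), hF.comp_contDiff contDiff_sqParam hφ0, by simp only [hφ0],
    fun c ↦ h𝓓 _, min ε 1, lt_min hε one_pos, fun c hc hcε ↦ hP _ ?_ ?_⟩
  · -- `0 < (c 0)²`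
    have hc0 : c 0 ≠ 0 := by
      intro h
      apply hc
      ext i
      fin_cases i
      simpa using h
    rw [hφc]
    positivity
  · -- `(c 0)² < ε`
    have hn : |c 0| ≤ ‖c‖ := by
      rw [EuclideanSpace.norm_eq c, Fin.sum_univ_one, Real.norm_eq_abs, Real.sqrt_sq (abs_nonneg _)]
    have h1 : |c 0| < 1 := hn.trans_lt (hcε.trans_le (min_le_right _ _))
    have hε' : |c 0| < ε := hn.trans_lt (hcε.trans_le (min_le_left _ _))
    have hsq : (c 0) ^ 2 ≤ |c 0| := by
      rw [← sq_abs]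
      nlinarith [abs_nonneg (c 0), h1]
    rw [hφc]
    exact hsq.trans_lt hε'

end OneSided

-- operator-norm instance paths on form-valued maps are slow to unify (clause (QS))
set_option synthInstance.maxHeartbeats 400000 in
/-- **`ModulatedKerrHandoff` FROM ONE-SIDED TAME ESCAPE** — the weakest free form of the core:
through every admissible datum failing the handoff property passes a TAME curve of admissible data
(no immersion, no injectivity) whose members with `0 < c₀ < ε` (ONE side of the parameter) have the
handoff property. Conclusion = the crux body verbatim. [cite: Christodoulou1999, p. A24] -/
theorem modulatedKerrHandoff_of_tameEscapeOneSided
    (hesc : ∀ (X : Type) [TopologicalSpace X] [ChartedSpace E3 X] [IsManifold (𝓡 3) ((⊤ : ℕ∞) : WithTop ℕ∞) X] [T2Space X] [SecondCountableTopology X] [ConnectedSpace X], ∀ d ∈ admissibleVacuumData X, ¬ HandoffPropT X d → ∃ (e : AFEnd X) (F : EuclideanSpace ℝ (Fin 1) → InitialDataSet (𝓡 3) X), IsTameDataFamily e 1 F ∧ F 0 = d ∧ (∀ c, F c ∈ admissibleVacuumData X) ∧ ∃ ε > (0 : ℝ), ∀ c, 0 < c 0 → c 0 < ε → HandoffPropT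 X (F c)) :
    ∀ (X : Type) [TopologicalSpace X] [ChartedSpace E3 X] [IsManifold (𝓡 3) ((⊤ : ℕ∞) : WithTop ℕ∞) X] [T2Space X] [SecondCountableTopology X] [ConnectedSpace X], InitialDataSet.IsTameChristodoulouGeneric (admissibleVacuumData X) (fun D ↦ (∃ 𝒟 : VacuumCauchyDevelopment D, 𝒟.IsMaximal) ∧ ∀ 𝒟 : VacuumCauchyDevelopment D, 𝒟.IsMaximal → Summit.FinalStateConjecture.HasCompleteNullInfinity 𝒟.toCauchyDevelopment ∧ (∃ (N : ℕ) (M a rin : Fin N → ℝ) (Λ : Fin N → ℝ → lorentzGroup) (ξ : Fin N → ℝ → E3) (γ κ τ₀ : ℝ) (U : Opens E4) (Φ : U → 𝒟.carrier) (O : Set 𝒟.carrier), (∀ i, Kerr.IsSubextremal (M i) (a i) ∧ Kerr.rMinus (M i) (a i) < rin i ∧ rin i < Kerr.rPlus (M i) (a i)) ∧ (∀ i t, |((Λ i t : E4 ≃L[ℝ] E4) (E4.basisVector 0)) 0| ≤ γ) ∧ (∀ i, ContDiff ℝ ((⊤ : ℕ∞) : WithTop ℕ∞) (ξ i) ∧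 ContDiff ℝ ((⊤ : ℕ∞) : WithTop ℕ∞) (fun t ↦ ((Λ i t : E4 ≃L[ℝ] E4) : E4 →L[ℝ] E4))) ∧ (∀ i j, i ≠ j → Tendsto (fun t ↦ ‖ξ i t - ξ j t‖) atTop atTop) ∧ (0 < κ ∧ κ < 1 ∧ ∀ i, ∀ᶠ t in atTop, ‖ξ i t‖ ≤ κ ^ 2 * t) ∧ ({x : E4 | τ₀ < x 0 ∧ ∀ i, rin i < Kerr.radius (a i) (poincareInv (Λ i (x 0)) (E4.ofTimeSpace (x 0) (ξ i (x 0))) x)} ⊆ (U : Set E4)) ∧ let B : ModelBackground := ⟨U, fun x ↦ Minkowski.bilin + ∑ i, (boostedKerrBilin (Λ i (x 0)) (E4.ofTimeSpace (x 0) (ξ i (x 0))) (M i) (a i) x - Minkowski.bilin), fun x ↦ x 0, E4.spatialNorm⟩; ContMDiff 𝓘(ℝ, E4) (𝓡 4) ((⊤ : ℕ∞) : WithTop ℕ∞) Φ ∧ Topology.IsOpenEmbedding ((B.lateRegion τ₀).restrict Φ) ∧ Φ '' {x : U | τ₀ < x.1 0 ∧ ∀ i, Kerr.rPlus (M i) (a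 i) < Kerr.radius (a i) (poincareInv (Λ i (x.1 0)) (E4.ofTimeSpace (x.1 0) (ξ i (x.1 0))) x.1)} ⊆ O ∧ Tendsto (fun t ↦ 𝒟.toSpacetime.deviationCk B Φ 3 t) atTop (𝓝 0) ∧ Tendsto (fun t : ℝ ↦ ⨆ x ∈ {x : U | x.1 0 = t ∧ E4.spatialNorm x.1 ≤ κ * t}, ⨆ (m : ℕ) (_ : m ≤ 3), ENNReal.ofReal (1 + √(√((⨅ i, ‖E4.spatial x.1 - ξ i t‖) ^ 7))) * ‖iteratedFDeriv ℝ m (𝒟.toSpacetime.deviationExtend B Φ) x.1‖ₑ) atTop (𝓝 0) ∧ O = Summit.FinalStateConjecture.exteriorOf 𝒟.toCauchyDevelopment (Φ '' {x : U | τ₀ < x.1 0 ∧ ∀ i, Kerr.rPlus (M i) (a i) < Kerr.radius (a i) (poincareInv (Λ i (x.1 0)) (E4.ofTimeSpace (x.1 0) (ξ i (x.1 0))) x.1)}) ∧ (∀ t₁ : ℝ, τ₀ < t₁ → O \ Φ '' {x : U | t₁ < x.1 0 ∧ ∀ i, Kerr.rPlus (M i) (a i) < Kerr.radius (a i) (poincareInv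 (Λ i (x.1 0)) (E4.ofTimeSpace (x.1 0) (ξ i (x.1 0))) x.1)} ⊆ 𝒟.metric.causalPast 𝒟.timeOrientation (Φ '' {x : U | x.1 0 = t₁ ∧ ∀ i, Kerr.rPlus (M i) (a i) < Kerr.radius (a i) (poincareInv (Λ i (x.1 0)) (E4.ofTimeSpace (x.1 0) (ξ i (x.1 0))) x.1)})) ∧ (∃ τ₁ : ℝ, ∀ x y : U, (τ₁ < x.1 0 ∧ ∀ i, rin i < Kerr.radius (a i) (poincareInv (Λ i (x.1 0)) (E4.ofTimeSpace (x.1 0) (ξ i (x.1 0))) x.1)) → (τ₁ < y.1 0 ∧ ∀ i, rin i < Kerr.radius (a i) (poincareInv (Λ i (y.1 0)) (E4.ofTimeSpace (y.1 0) (ξ i (y.1 0))) y.1)) → Φ y ∈ 𝒟.metric.causalFuture 𝒟.timeOrientation {Φ x} → x.1 0 ≤ y.1 0) ∧ (∀ (i : Fin N) (t : ℝ), 0 < (((Λ i t : lorentzGroup) : E4 ≃L[ℝ] E4) (E4.basisVector 0)) 0) ∧ Summit.FinalStateConjecture.RaysStayInClosure 𝒟.toCauchyDevelopment O ∧ (∀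 ρ : ℝ → ℝ, Tendsto ρ atTop atTop → Tendsto (fun t : ℝ ↦ ⨆ x ∈ {x : E4 | x 0 = t ∧ E4.spatialNorm x ≤ κ * t ∧ ρ t ≤ ⨅ i, ‖E4.spatial x - ξ i t‖}, ENNReal.ofReal (1 + √(√((⨅ i, ‖E4.spatial x - ξ i t‖) ^ 7))) * ‖fderiv ℝ (fun y : E4 ↦ Minkowski.bilin + ∑ i, (boostedKerrBilin (Λ i (y 0)) (E4.ofTimeSpace (y 0) (ξ i (y 0))) (M i) (a i) y - Minkowski.bilin)) x (E4.basisVector 0)‖ₑ) atTop (𝓝 0)))) 1 := by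
  refine modulatedKerrHandoff_of_tameEscape fun X _ _ _ _ _ _ d hd hP ↦ ?_
  obtain ⟨e, F, hF, hF0, hF𝓓, ε, hε, hgood⟩ := hesc X d hd hP
  obtain ⟨F', hF', hF'0, hF'𝓓, ε', hε', hgood'⟩ :=
    exists_tameCurve_of_oneSided (P := HandoffPropT X) hF hF𝓓 hε hgood
  exact ⟨e, F', hF', hF'0.trans hF0, hF'𝓓, ε', hε', hgood'⟩

end Summit.FinalStateConjecture.FinalStateConjecture.Theorems.EIHFluxBalance.TameTemplate

end
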